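import Literature.NumberTheory.ComplexMultiplication.CMTypeCountingFormulas
import Literature.NumberTheory.ComplexMultiplication.PrimitiveCMTypeExistenceNonGalois
import Literature.NumberTheory.ComplexMultiplication.CMTori
import HarnessLib

/-!
# Counting formulas for CM types (Kida 2019), II: degenerate CM types from the reflex subgroup (§5), Lemma 6.1,
# Example 6.2, and the number of primitive CM types of a CM field

Layer `Literature/NumberTheory/ComplexMultiplication`; sequel of `CMTypeCountingFormulas` (Kida 2019 §§1–4: the sets
`X(H,K)`, `𝒮(H)`, `CM(G,H,ρ)`, `ℛ(K)`, the function `ε`, Lemma 2.3, Theorem 2.4, Proposition 3.1, Theorem 4.1), same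
conventions: `G` finite, `ρ` a central involution, half-systems `S ⊆ G` with `S·H = S` (Schmidt), right stabiliser =
Kida's `s(S)` (field subgroup), left stabiliser = Kida's `r(S)` (reflex subgroup), under the dictionary `S ↦ S⁻¹`.
Source of record: M. Kida, *Counting formulas for CM-types*, Moscow J. Combin. Number Theory 8 (2019) 343–355
[Kida2019CountingCMTypes] (held `paper:doi-10-2140-moscow-2019-8-343`).  Everything is PROVED; three small honest
definitions (`cosetType`, the CM type on `G ⧸ H` of a half-system; `liftFinset`, `sweep` for the dictionary of §9); no
named fact (D-0026).

* §6 the CM type `Φ_S ⊆ G ⧸ H` of a half-system with `S·H = S` is a CM type of the transitive `G`-set `G ⧸ H` in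
  the tree's sense (`IsCMTypeWith`), its stabiliser is `r(S)` and its orbit has `(G : r(S)) = [L_{r(S)} : ℚ]`
  elements; KUBOTA's bound `rank Φ_S ≤ ½(G:H) + 1` and RIBET's bound [Ribet 1980, (3.5)] `rank Φ_S ≤ ½(G:r(S)) + 1`
  as quoted in §5 (tree: `IsCMTypeWith.typeRank_le`, `IsCMTypeWith.typeRank_le_card_orbit`); PROPOSITION 5.1 («If
  `X(H,K) ≠ ∅` for some `H, K ∈ 𝓗` such that `|H| ≠ |K|`, then there exists a degenerate CM-type in `CM(G,H,ρ)` or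
  `CM(G,K,ρ)`») and PROPOSITION 5.2 in the form its proof gives.
* §7 LEMMA 6.1 («If `H ∈ 𝓗` is a normal subgroup of `G` such that `G/H ≅ C₂ × C₂` or `D₄`, then `𝒮(H) = ℛ(H) = ∅`»)
  together with Schappacher's converse, from the tree's Schmidt Kap. II Satz 1.6 at group level
  (`PrimitiveHalfSystemNonNormal.exists_rightStabiliser_eq_iff`); hence Kida's sum `Σ_{N ⊇ H} μ(H,N) 2^{½(G:N)}`
  vanishes for such `H` («`|𝒮(1)| = 2² − 2·2 = 0` … `2⁴ − 4·2² = 0`»).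
* §8 EXAMPLE 6.2 (the cyclic group `C_{2p}`, `p` an odd prime): the CM subgroups are `1` and the subgroup `P` of
  order `p` (`rho_not_mem_iff_of_isCyclic`); `|X(1,1)| = 2^p − 2`, `|X(P,P)| = 2` (`card_X_of_isCyclic`);
  `c(G,P,ρ) = 1` and `c(G,1,ρ) = (2^{p−1} − 1)/p + 1` with `p ∣ 2^{p−1} − 1` («an integer by Fermat's theorem»;
  `card_orbits_of_isCyclic`) — first for any commutative `G` whose CM subgroups are `1` and one index-`2` subgroup.
* §9 THE DICTIONARY WITH THE TREE'S CM TYPES ON A TRANSITIVE `G`-SET (`E = Hom(K, L)`, `H = Stab(φh) = Gal(L/K)`,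
  Shimura's `S = {g | g·φh ∈ Φ}` = `ReflexType.typeLift`): `Φ ↦ liftFinset Φ φh` is a bijection from the CM types
  `IsCMTypeWith ρ Φ` of `E` onto `CM(G, Stab(φh), ρ)`, under which `ReflexType.IsPrimitive` (Shimura §8.2 Prop. 26)
  is Kida's «simple»; hence **the number of PRIMITIVE CM types** of a finite transitive `G`-set is Kida's
  `Σ_{N ⊇ H, ρ ∉ N} μ(H, N)·2^{½(G:N)}` (`natCard_isPrimitive_eq_sum`), and the number of all CM types is
  `2^{½(G:H)}` (`natCard_isCMTypeWith_eq`).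
* §10 FIELD LEVEL: for a CM field `K`, a normal CM field `L ⊇ χ₀(K)` and `ι : L → ℂ`, through the tree's dictionary
  `cmTypeEquivIsCMTypeWithGal` and `PrimitiveCMTypeNonGalois.isPrimitive_iff_isPrimitive_algValuedIn`: **the number of
  PRIMITIVE complex CM types `Θ : CMType K` (`IsPrimitive (ℂ ≃+* ℂ) Θ φ₀`) is Kida's sum
  `Σ_{N ⊇ Gal(L/χ₀K), ρ ∉ N} μ(Gal(L/χ₀K), N)·2^{½(Gal(L/ℚ):N)}`** over the CM subfields of `L` containing `χ₀(K)`
  (`natCard_isPrimitive_cmType_eq_sum`, `…_fixingSubgroup`).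

HONEST COLUMN.  Proposition 5.2 is printed with the conclusion «there exists a degenerate CM-type in `CM(G, H, ρ)`»;
its proof («If `|r(S)| < |H|`, then replacing `H` by `r(S)`, we obtain a CM-type satisfying `|r(S)| > |H|`») yields a
degenerate type of `(G, r(S), ρ)` in that case, which is what is typed here (`degenerate_or_degenerate_inv_of_simple`);
the printed conclusion fails for the generic sextic CM field (`G = C₂ ≀ S₃` of order `48`, `H` of order `8`: all
eight CM types are simple with `|r(S)| = 6 ≠ 8` and all are nondegenerate, Dodson's case `v = n`).  «Degenerate» for
`(G, H, ρ)` is typed as `rank Φ_S < ½(G:H) + 1` (Kida: «nondegenerate if the rank is maximal, `rank Φ_S =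
½|H\G| + 1`; otherwise degenerate»).  Examples 6.3–6.5 (`D_{2p}`, `C_{2^k} ⋊ C₂`, `C₂ ≀ C_d`) are not typed
here; the construction of CM fields with Galois group `C_{2p}` (last paragraph of Ex. 6.2) is the tree's
`AbelianCMFieldsCyclicOverImaginaryQuadratic.exists_abelianCMField_gal_cyclicTimesConj`.

## References

* [Kida2019CountingCMTypes] M. Kida, *Counting formulas for CM-types*, Moscow J. Combin. Number Theory 8 (2019)
  343–355 — §5 (the map `Φ_S`, Ribet's bound, Prop. 5.1, Prop. 5.2), §6 Lemma 6.1, Example 6.2.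
* [Ribet1980] K. A. Ribet, *Division fields of abelian varieties with complex multiplication*, Mém. SMF 2 (1980),
  (3.5) (through Kida §5 and the tree's `CMTori`).
* [Schmidt1984CMArithmetik] C.-G. Schmidt, LNM 1082, Kap. II Satz 1.6 (= [Schappacher1977PrimitiveCMTypes]; tree
  `PrimitiveHalfSystemNonNormalSubgroup`).

## Provenance

Cell `pub-hodgecm2` (COR-CM), literature seat `lit-deligne-3` gen 26 (PORTFOLIO-PASS «Deligne 1982 continued:
CM-type combinatorics»; claim KIDA-COUNT; count-neutral).  `HC_CM` is neither used nor implied.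
-/

set_option autoImplicit false

noncomputable section

open scoped Classical Pointwise BigOperators

namespace Literature.NumberTheory.ComplexMultiplication

namespace CMTypeCounting

variable {G : Type*} [Group G]

/-! ## §6 The CM type on `G ⧸ H` of a half-system and the rank bounds of Kubota and Ribet (Kida §5) -/

section CosetType

/-- The CM type ON THE COSET SPACE `G ⧸ H` attached to a half-system `S` with `S·H = S`: the set of left cosets
`gH ⊆ S` — Kida's `S ⊂ H\G` itself, of which `S̃ ⊆ G` is the pull-back (read through `S ↦ S⁻¹`).
[cite: Kida2019CountingCMTypes, §1] -/
def cosetType (H : Subgroup G) (S : Finset G) : Set (G ⧸ H) := {q | ∃ g ∈ S, (g : G ⧸ H) = q}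

variable {ρ : G} {H : Subgroup G} {S : Finset G}

/-- For `S·H = S`: `gH ∈ cosetType H S ↔ g ∈ S`. [cite: Kida2019CountingCMTypes, §1] -/
theorem mk_mem_cosetType_iff (hH : H ≤ rightStab S) (g : G) : (g : G ⧸ H) ∈ cosetType H S ↔ g ∈ S := by
  constructor
  · rintro ⟨g', hg', hEq⟩
    have h1 : g'⁻¹ * g ∈ H := QuotientGroup.eq.1 hEq
    have h2 := (mem_rightStab_iff.1 (hH h1)) g'
    rw [mul_inv_cancel_left] at h2
    exact h2.2 hg'
  · intro hg
    exact ⟨g, hg, rfl⟩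

/-- The coset type of a half-system with `S·H = S` is a CM type of the `G`-set `G ⧸ H` for `ρ` in the tree's sense
(`IsCMTypeWith`: `ρ` central involution, `q ∈ Φ ↔ ρq ∉ Φ`). [cite: Kida2019CountingCMTypes, §1] -/
theorem isCMTypeWith_cosetType (hS : IsHalfSystem ρ S) (hρc : ∀ g : G, g * ρ = ρ * g) (hρ2 : ρ * ρ = 1)
    (hH : H ≤ rightStab S) : IsCMTypeWith ρ (cosetType H S) where
  mem_iff q := by
    induction q using QuotientGroup.induction_on with
    | H g =>
      rw [MulAction.Quotient.smul_coe, smul_eq_mul, mk_mem_cosetType_iff hH, mk_mem_cosetType_iff hH]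
      exact hS g
  comm g q := by
    induction q using QuotientGroup.induction_on with
    | H x =>
      rw [MulAction.Quotient.smul_coe, MulAction.Quotient.smul_coe, MulAction.Quotient.smul_coe,
        MulAction.Quotient.smul_coe, smul_eq_mul, smul_eq_mul, smul_eq_mul, smul_eq_mul, ← mul_assoc, hρc g,
        mul_assoc]
  invol q := by
    induction q using QuotientGroup.induction_on with
    | H x =>
      rw [MulAction.Quotient.smul_coe, MulAction.Quotient.smul_coe, smul_eq_mul, smul_eq_mul, ← mul_assoc, hρ2,
        one_mul]

/-- The stabiliser of the coset type under `G` (acting on subsets of `G ⧸ H`) is the reflex subgroup `r(S)`, so that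
its orbit — the Galois conjugates of the type, `[K' : ℚ]` of them — has `(G : r(S))` elements.
[cite: Kida2019CountingCMTypes, Rem. 4.3] -/
theorem stabilizer_cosetType (hH : H ≤ rightStab S) : MulAction.stabilizer G (cosetType H S) = leftStab S := by
  ext g
  rw [MulAction.mem_stabilizer_iff, mem_leftStab_iff, Set.ext_iff]
  constructor
  · intro h x
    have h1 := h ((g * x : G) : G ⧸ H)
    rw [Set.mem_smul_set_iff_inv_smul_mem, MulAction.Quotient.smul_coe, smul_eq_mul, inv_mul_cancel_left,
      mk_mem_cosetType_iff hH, mk_mem_cosetType_iff hH] at h1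
    exact h1.symm
  · intro h q
    induction q using QuotientGroup.induction_on with
    | H x =>
      rw [Set.mem_smul_set_iff_inv_smul_mem, MulAction.Quotient.smul_coe, smul_eq_mul, mk_mem_cosetType_iff hH,
        mk_mem_cosetType_iff hH]
      have h1 := h (g⁻¹ * x)
      rw [mul_inv_cancel_left] at h1
      exact h1.symm

/-- `|G·Φ_S| = (G : r(S))` («we see `[L_K : ℚ] = |G|/|K|`, where `L_K` is the reflex field»).
[cite: Kida2019CountingCMTypes, Rem. 4.3] -/
theorem natCard_orbit_cosetType (hH : H ≤ rightStab S) :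
    Nat.card (MulAction.orbit G (cosetType H S)) = (leftStab S).index := by
  rw [← stabilizer_cosetType hH, MulAction.index_stabilizer, Nat.card_coe_set_eq]

variable [Fintype G]

/-- **Kubota's bound in Kida's normalisation**: `rank Φ_S ≤ ½|H\G| + 1` («the rank of `Φ_S` is less than or equal
to `½|H\G| + 1`»; tree: `IsCMTypeWith.typeRank_le`). [cite: Kida2019CountingCMTypes, §5] -/
theorem typeRank_cosetType_le_index (hS : S ∈ cmTypes ρ H) (hρc : ∀ g : G, g * ρ = ρ * g) (hρ2 : ρ * ρ = 1) :
    typeRank G (cosetType H S) ≤ H.index / 2 + 1 := by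
  rw [mem_cmTypes] at hS
  have h := (isCMTypeWith_cosetType hS.1 hρc hρ2 hS.2).typeRank_le
  rwa [← Nat.card_eq_fintype_card, ← Subgroup.index_eq_card] at h

/-- **Ribet's bound [Ribet 1980, (3.5)] in Kida's normalisation**: `rank Φ_S ≤ ½|r(S)\G| + 1` — the rank is at most
one more than half the degree of the REFLEX field («we know the rank of `Φ_S` is less than or equal to
`min{½|H\G| + 1, ½|H'\G| + 1}` by [Ribet 1980, (3.5)]»; tree: `IsCMTypeWith.typeRank_le_card_orbit`, Shimura §32.10).
[cite: Kida2019CountingCMTypes, §5] -/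
theorem typeRank_cosetType_le_index_leftStab (hS : S ∈ cmTypes ρ H) (hρc : ∀ g : G, g * ρ = ρ * g)
    (hρ2 : ρ * ρ = 1) : typeRank G (cosetType H S) ≤ (leftStab S).index / 2 + 1 := by
  rw [mem_cmTypes] at hS
  have h := (isCMTypeWith_cosetType hS.1 hρc hρ2 hS.2).typeRank_le_card_orbit ((1 : G) : G ⧸ H)
  rwa [natCard_orbit_cosetType hS.2] at h

/-! ### Proposition 5.1: degenerate CM types from `|r(S)| ≠ |s(S)|` -/

/-- A larger subgroup has a smaller index. [folklore] -/
private theorem index_lt_index_of_card_lt {H K : Subgroup G} (h : Nat.card H < Nat.card K) : K.index < H.index := by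
  have hH := H.card_mul_index
  have hK := K.card_mul_index
  have hKpos : 0 < Nat.card K := Nat.card_pos
  by_contra hle
  rw [not_lt] at hle
  have : Nat.card H * H.index < Nat.card K * K.index :=
    lt_of_lt_of_le (Nat.mul_lt_mul_of_lt_of_le h le_rfl (Nat.pos_of_ne_zero fun h0 => by
      rw [h0, mul_zero] at hH; exact Nat.card_pos.ne' hH.symm |>.elim)) (Nat.mul_le_mul_left _ hle)
  rw [hH, hK] at this
  exact lt_irrefl _ this

/-- **The mechanism of PROPOSITION 5.1**: a CM type of `(G, H, ρ)` whose reflex subgroup has MORE elements than `H`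
(reflex field of smaller degree than `L^H`) is DEGENERATE: `rank Φ_S ≤ ½(G : r(S)) + 1 < ½(G : H) + 1`.
[cite: Kida2019CountingCMTypes, Prop. 5.1] -/
theorem typeRank_cosetType_lt_of_card_lt (hρc : ∀ g : G, g * ρ = ρ * g) (hρ2 : ρ * ρ = 1) (hS : S ∈ cmTypes ρ H)
    (hlt : Nat.card H < Nat.card (leftStab S)) : typeRank G (cosetType H S) < H.index / 2 + 1 := by
  have h1 := typeRank_cosetType_le_index_leftStab hS hρc hρ2
  have h2 := index_lt_index_of_card_lt hlt
  have hS' := mem_cmTypes.1 hS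
  obtain ⟨a, ha⟩ := even_index hρc hρ2 (hS'.1.rho_not_mem_of_le_rightStab hρc hρ2 hS'.2)
  obtain ⟨b, hb⟩ := even_index hρc hρ2 (hS'.1.rho_not_mem_leftStab hρ2)
  omega

/-- **PROPOSITION 5.1.** «If `X(H, K) ≠ ∅` for some `H, K ∈ 𝓗` such that `|H| ≠ |K|`, then there exists a degenerate
CM-type in `CM(G, H, ρ)` or `CM(G, K, ρ)`»: an `S ∈ X(H, K)` is degenerate for `(G, H, ρ)` if `|H| < |K|`, and its
inverse `S⁻¹ ∈ X(K, H)` is degenerate for `(G, K, ρ)` if `|K| < |H|` (degenerate: `rank < ½(G : H) + 1`).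
[cite: Kida2019CountingCMTypes, Prop. 5.1] -/
theorem exists_degenerate_of_X_nonempty (hρc : ∀ g : G, g * ρ = ρ * g) (hρ2 : ρ * ρ = 1) {K : Subgroup G}
    (hX : (X ρ H K).Nonempty) (hne : Nat.card H ≠ Nat.card K) :
    (∃ S ∈ cmTypes ρ H, typeRank G (cosetType H S) < H.index / 2 + 1) ∨
      ∃ S ∈ cmTypes ρ K, typeRank G (cosetType K S) < K.index / 2 + 1 := by
  obtain ⟨S, hS⟩ := hX
  rw [mem_X] at hS
  obtain ⟨hS, rfl, rfl⟩ := hS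
  rcases lt_or_gt_of_ne hne with h | h
  · left
    refine ⟨S, mem_cmTypes.2 ⟨hS, le_rfl⟩, typeRank_cosetType_lt_of_card_lt hρc hρ2 (mem_cmTypes.2 ⟨hS, le_rfl⟩) h⟩
  · right
    refine ⟨S⁻¹, mem_cmTypes.2 ⟨hS.inv hρc hρ2, by rw [rightStab_inv]⟩,
      typeRank_cosetType_lt_of_card_lt hρc hρ2 (mem_cmTypes.2 ⟨hS.inv hρc hρ2, by rw [rightStab_inv]⟩) ?_⟩
    rwa [leftStab_inv]

/-- **PROPOSITION 5.2 (in the form its proof gives).**  «Let `H ∈ 𝓗`.  Assume that `ε(H, K) = 0` for all `K ∈ 𝓗`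
such that `|K| = |H|`.  If there exists a simple CM-type `S` in `CM(G, H, ρ)`», then `|r(S)| ≠ |H|`, and either `S`
is degenerate for `(G, H, ρ)` (case `|r(S)| > |H|`) or `S⁻¹ ∈ CM(G, r(S), ρ)` is degenerate for `(G, r(S), ρ)`
(case `|r(S)| < |H|`: «replacing `H` by `r(S)`, we obtain a CM-type satisfying `|r(S)| > |H|`»).  The printed
conclusion «a degenerate CM-type in `CM(G, H, ρ)`» is not what the proof yields in the second case, and fails e.g.
for a maximal CM subgroup `H` all of whose (necessarily simple) types have a larger reflex field and full rank (the
generic sextic CM field: `G = C₂ ≀ S₃`, `|H| = 8`, `|r(S)| = 6`, all eight types nondegenerate).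
[cite: Kida2019CountingCMTypes, Prop. 5.2] -/
theorem degenerate_or_degenerate_inv_of_simple (hρc : ∀ g : G, g * ρ = ρ * g) (hρ2 : ρ * ρ = 1)
    (hε : ∀ K : Subgroup G, ρ ∉ K → Nat.card K = Nat.card H → ¬ Eps ρ H K) (hS : S ∈ simpleTypes ρ H) :
    Nat.card (leftStab S) ≠ Nat.card H ∧
      (typeRank G (cosetType H S) < H.index / 2 + 1 ∨
        typeRank G (cosetType (leftStab S) S⁻¹) < (leftStab S).index / 2 + 1) := by
  rw [mem_simpleTypes] at hS
  have hX : S ∈ Xbar ρ H (leftStab S) := mem_Xbar.2 ⟨hS.1, hS.2.ge, le_rfl⟩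
  have hεHK : Eps ρ H (leftStab S) := (Xbar_nonempty_iff hρc hρ2).1 ⟨S, hX⟩
  have hne : Nat.card (leftStab S) ≠ Nat.card H := fun h =>
    hε (leftStab S) (hS.1.rho_not_mem_leftStab hρ2) h hεHK
  refine ⟨hne, ?_⟩
  have hX' : (X ρ H (leftStab S)).Nonempty := ⟨S, mem_X.2 ⟨hS.1, hS.2, rfl⟩⟩
  rcases lt_or_gt_of_ne hne.symm with h | h
  · left
    exact typeRank_cosetType_lt_of_card_lt hρc hρ2 (mem_cmTypes.2 ⟨hS.1, hS.2.ge⟩) h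
  · right
    refine typeRank_cosetType_lt_of_card_lt hρc hρ2
      (mem_cmTypes.2 ⟨hS.1.inv hρc hρ2, by rw [rightStab_inv]⟩) ?_
    rwa [leftStab_inv, hS.2]

end CosetType

/-! ## §7 Lemma 6.1 (and Schappacher's converse) in Kida's form -/

section LemmaSixOne

variable [Fintype G] {ρ : G}

/-- **Simple CM types of `(G, H, ρ)` exist iff `H` is not normal with quotient `V₄` or `D₄`** — Kida's LEMMA 6.1
(«If `H ∈ 𝓗` is a normal subgroup of `G` such that the quotient `G/H` is isomorphic to either `C₂ × C₂` or `D₄`, then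
`𝒮(H) = ℛ(H) = ∅`») together with its converse («Schappacher [1977] proved that the converse of Lemma 6.1 also
holds»), from the tree's group-level Satz 1.6 of Schmidt LNM 1082 Kap. II
(`PrimitiveHalfSystemNonNormal.exists_rightStabiliser_eq_iff`). [cite: Kida2019CountingCMTypes, Lemma 6.1] -/
theorem simpleTypes_nonempty_iff (hρc : ∀ g : G, g * ρ = ρ * g) (hρ2 : ρ * ρ = 1) {H : Subgroup G} (hH : ρ ∉ H) :
    (simpleTypes ρ H).Nonempty ↔ ∀ [H.Normal], ¬ IsKleinFour (G ⧸ H) ∧ IsEmpty (G ⧸ H ≃* DihedralGroup 4) := by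
  rw [← PrimitiveHalfSystemNonNormal.exists_rightStabiliser_eq_iff hρc hρ2 hH]
  constructor
  · rintro ⟨S, hS⟩
    rw [mem_simpleTypes] at hS
    refine ⟨↑S, fun x => by exact_mod_cast hS.1 x, fun x h hh => ?_, fun γ hγ => ?_⟩
    · exact_mod_cast (mem_rightStab_iff.1 (hS.2.ge hh)) x
    · rw [← hS.2]
      exact mem_rightStab_iff.2 fun x => by exact_mod_cast hγ x
  · rintro ⟨T, hT, hTH, hW⟩
    refine ⟨T.toFinset, mem_simpleTypes.2 ⟨fun x => by simpa using hT x, le_antisymm ?_ ?_⟩⟩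
    · intro γ hγ
      exact hW γ fun x => by simpa using (mem_rightStab_iff.1 hγ) x
    · intro h hh
      exact mem_rightStab_iff.2 fun x => by simpa using hTH x h hh

/-- **LEMMA 6.1 (Kida).**  If `H` is normal with `G/H ≅ C₂ × C₂` or `G/H ≅ D₄` then `𝒮(H) = ∅` and `ℛ(H) = ∅`: no
half-system has field subgroup exactly `H`, and none has reflex subgroup exactly `H` («In particular, every CM
abelian variety with CM-types in `CM(G, H, ρ)` splits»). [cite: Kida2019CountingCMTypes, Lemma 6.1] -/
theorem simpleTypes_eq_empty_of_quotient (hρc : ∀ g : G, g * ρ = ρ * g) (hρ2 : ρ * ρ = 1) {H : Subgroup G}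
    [H.Normal] (h : IsKleinFour (G ⧸ H) ∨ Nonempty (G ⧸ H ≃* DihedralGroup 4)) :
    simpleTypes ρ H = ∅ ∧ reflexTypes ρ H = ∅ := by
  by_cases hH : ρ ∈ H
  · constructor
    · rw [Finset.eq_empty_iff_forall_notMem]
      intro S hS
      rw [mem_simpleTypes] at hS
      exact hS.1.rho_not_mem_rightStab hρc hρ2 (hS.2 ▸ hH)
    · rw [Finset.eq_empty_iff_forall_notMem]
      intro S hS
      rw [mem_reflexTypes] at hS
      exact hS.1.rho_not_mem_leftStab hρ2 (hS.2 ▸ hH)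
  have h1 : simpleTypes ρ H = ∅ := by
    by_contra hne
    have hne' : (simpleTypes ρ H).Nonempty := Finset.nonempty_iff_ne_empty.2 hne
    have := (simpleTypes_nonempty_iff hρc hρ2 hH).1 hne'
    rcases h with h | hne2
    · exact this.1 h
    · exact this.2.false hne2.some
  refine ⟨h1, ?_⟩
  rw [← Finset.card_eq_zero, card_reflexTypes_eq_card_simpleTypes hρc hρ2, h1, Finset.card_empty]

/-- Lemma 6.1 through the counting formula, as in print: if `H` is normal with `G/H ≅ C₂ × C₂` or `D₄` then Kida's
sum `Σ_{N ∈ 𝓗(H)} μ(H, N)·2^{½|N\G|}` VANISHES («for `G = C₂ × C₂` we have `|𝒮(1)| = 2² − 2·2 = 0` and for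
`G = D₄` we have `|𝒮(1)| = 2⁴ − 4·2² = 0`»). [cite: Kida2019CountingCMTypes, Lemma 6.1 (proof)] -/
theorem sum_mu_eq_zero_of_quotient (hρc : ∀ g : G, g * ρ = ρ * g) (hρ2 : ρ * ρ = 1) {H : Subgroup G}
    [H.Normal] (h : IsKleinFour (G ⧸ H) ∨ Nonempty (G ⧸ H ≃* DihedralGroup 4)) :
    ∑ N ∈ (Finset.Ici H).filter (fun N => ρ ∉ N), IncidenceAlgebra.mu ℤ H N * 2 ^ (N.index / 2) = 0 := by
  rw [← card_simpleTypes_eq_sum hρc hρ2, (simpleTypes_eq_empty_of_quotient hρc hρ2 h).1, Finset.card_empty,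
    Nat.cast_zero]

end LemmaSixOne

/-! ## §8 Example 6.2: the cyclic group `C_{2p}` -/

section ExampleCyclic

variable [Fintype G] {ρ : G}

omit [Fintype G] in
/-- In a COMMUTATIVE group the two stabilisers of any `S ⊆ G` coincide (`r(S) = s(S)`). [cite: Kida2019CountingCMTypes, Ex. 6.2] -/
theorem leftStab_eq_rightStab_of_forall_comm (hcomm : ∀ a b : G, a * b = b * a) (S : Finset G) :
    leftStab S = rightStab S := by
  ext g
  rw [mem_leftStab_iff, mem_rightStab_iff]
  exact forall_congr' fun x => by rw [hcomm g x]

/-- The frame of Example 6.2: a COMMUTATIVE `G` whose CM subgroups are exactly `1` and one subgroup `P` of index `2`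
(for `G = C_{2p} = ⟨x⟩`: `𝓗 = {⟨x²⟩, 1}`).  Then every CM type of `(G, P, ρ)` is simple: `𝒮(P) = CM(G, P, ρ)` has
`2` elements («`|X(⟨x²⟩, ⟨x²⟩)| = μ(⟨x²⟩, ⟨x²⟩)·2 = 2`»). [cite: Kida2019CountingCMTypes, Ex. 6.2] -/
theorem card_simpleTypes_eq_two_of_cmSubgroups (hρc : ∀ g : G, g * ρ = ρ * g) (hρ2 : ρ * ρ = 1) {P : Subgroup G}
    (hCM : ∀ K : Subgroup G, ρ ∉ K ↔ K = ⊥ ∨ K = P) (hP : P.index = 2) (hPb : P ≠ ⊥) :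
    simpleTypes ρ P = cmTypes ρ P ∧ (simpleTypes ρ P).card = 2 := by
  have hρP : ρ ∉ P := (hCM P).2 (Or.inr rfl)
  have h1 : simpleTypes ρ P = cmTypes ρ P := by
    ext S
    rw [mem_simpleTypes, mem_cmTypes]
    constructor
    · rintro ⟨hS, h⟩
      exact ⟨hS, h.ge⟩
    · rintro ⟨hS, h⟩
      refine ⟨hS, ?_⟩
      rcases (hCM (rightStab S)).1 (hS.rho_not_mem_rightStab hρc hρ2) with h0 | h0
      · exact absurd (le_bot_iff.1 (h0 ▸ h)) hPb
      · exact h0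
  refine ⟨h1, ?_⟩
  rw [h1, card_cmTypes hρc hρ2, if_neg hρP, hP]
  rfl

/-- Example 6.2, continued: the simple CM types of `(G, 1, ρ)` number `2^{|G|/2} − 2` («`|X(1, 1)| = μ(1,1)² 2^p +
2μ(1,1)μ(1,⟨x²⟩)·2 + μ(1,⟨x²⟩)²·2 = 2^p − 2`»; here: all `2^{|G|/2}` half-systems minus the `2` with stabiliser `P`).
[cite: Kida2019CountingCMTypes, Ex. 6.2] -/
theorem card_simpleTypes_bot_of_cmSubgroups (hρc : ∀ g : G, g * ρ = ρ * g) (hρ2 : ρ * ρ = 1) {P : Subgroup G}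
    (hCM : ∀ K : Subgroup G, ρ ∉ K ↔ K = ⊥ ∨ K = P) (hP : P.index = 2) (hPb : P ≠ ⊥) :
    (simpleTypes ρ (⊥ : Subgroup G)).card = 2 ^ (Fintype.card G / 2) - 2 := by
  have hρ1 : ρ ≠ 1 := fun h => ((hCM ⊥).2 (Or.inl rfl)) (h ▸ (⊥ : Subgroup G).one_mem)
  obtain ⟨hSP, h2⟩ := card_simpleTypes_eq_two_of_cmSubgroups hρc hρ2 hCM hP hPb
  have hunion : halfSystems ρ = simpleTypes ρ ⊥ ∪ simpleTypes ρ P := by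
    ext S
    rw [Finset.mem_union, mem_halfSystems, mem_simpleTypes, mem_simpleTypes]
    constructor
    · intro hS
      rcases (hCM (rightStab S)).1 (hS.rho_not_mem_rightStab hρc hρ2) with h0 | h0
      · exact Or.inl ⟨hS, h0⟩
      · exact Or.inr ⟨hS, h0⟩
    · rintro (⟨hS, -⟩ | ⟨hS, -⟩) <;> exact hS
  have hdisj : Disjoint (simpleTypes ρ ⊥) (simpleTypes ρ P) := by
    rw [Finset.disjoint_left]
    intro S h0 h1'
    rw [mem_simpleTypes] at h0 h1'
    exact hPb (h1'.2.symm.trans h0.2)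
  have := card_halfSystems hρc hρ2 hρ1
  rw [hunion, Finset.card_union_of_disjoint hdisj, h2] at this
  omega

/-- Example 6.2, continued: for commutative `G` the two stabilisers agree, so `X(1,1) = 𝒮(1)` and `X(P,P) = 𝒮(P)`:
`|X(1, 1)| = 2^{|G|/2} − 2` and `|X(P, P)| = 2` («We have to compute only `|X(1,1)|` and `|X(⟨x²⟩,⟨x²⟩)|`»).
[cite: Kida2019CountingCMTypes, Ex. 6.2] -/
theorem card_X_of_cmSubgroups (hρ2 : ρ * ρ = 1) (hcomm : ∀ a b : G, a * b = b * a) {P : Subgroup G}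
    (hCM : ∀ K : Subgroup G, ρ ∉ K ↔ K = ⊥ ∨ K = P) (hP : P.index = 2) (hPb : P ≠ ⊥) :
    (X ρ (⊥ : Subgroup G) ⊥).card = 2 ^ (Fintype.card G / 2) - 2 ∧ (X ρ P P).card = 2 := by
  have hρc : ∀ g : G, g * ρ = ρ * g := fun g => hcomm g ρ
  have hX : ∀ K : Subgroup G, X ρ K K = simpleTypes ρ K := fun K => by
    ext S
    rw [mem_X, mem_simpleTypes]
    constructor
    · rintro ⟨hS, h, -⟩
      exact ⟨hS, h⟩
    · rintro ⟨hS, h⟩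
      exact ⟨hS, h, by rw [leftStab_eq_rightStab_of_forall_comm hcomm, h]⟩
  rw [hX, hX, card_simpleTypes_bot_of_cmSubgroups hρc hρ2 hCM hP hPb,
    (card_simpleTypes_eq_two_of_cmSubgroups hρc hρ2 hCM hP hPb).2]
  exact ⟨rfl, rfl⟩

/-- Example 6.2, continued: the number of conjugacy classes: `|G|·c(G, P, ρ) = |G|` (one class of CM types of the
index-`2` CM subfield, «`c(G, ⟨x²⟩, ρ) = 1`») and `|G|·c(G, 1, ρ) = 2^{|G|/2} − 2 + |G|` (the `2^{|G|/2} − 2` simple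
types have trivial stabiliser, the other `2` have stabiliser `P` of order `|G|/2`). [cite: Kida2019CountingCMTypes, Ex. 6.2] -/
theorem card_orbits_of_cmSubgroups (hρ2 : ρ * ρ = 1) (hcomm : ∀ a b : G, a * b = b * a) {P : Subgroup G}
    (hCM : ∀ K : Subgroup G, ρ ∉ K ↔ K = ⊥ ∨ K = P) (hP : P.index = 2) (hPb : P ≠ ⊥) :
    Nat.card (MulAction.orbitRel.Quotient G (cmTypesSubMulAction ρ (fun g => hcomm g ρ) P)) = 1 ∧
      Nat.card (MulAction.orbitRel.Quotient G (cmTypesSubMulAction ρ (fun g => hcomm g ρ) ⊥)) * Nat.card G =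
        2 ^ (Fintype.card G / 2) - 2 + Nat.card G := by
  have hρc : ∀ g : G, g * ρ = ρ * g := fun g => hcomm g ρ
  obtain ⟨hSP, h2⟩ := card_simpleTypes_eq_two_of_cmSubgroups hρc hρ2 hCM hP hPb
  have hcardP : Nat.card P * 2 = Nat.card G := by rw [← hP]; exact P.card_mul_index
  constructor
  · have h := card_orbits_mul_card_group hρc P
    have hsum : ∑ S ∈ cmTypes ρ P, Nat.card (leftStab S) = 2 * Nat.card P := by
      rw [← hSP, Finset.sum_const_nat (m := Nat.card P) fun S hS => ?_, h2]
      rw [mem_simpleTypes] at hS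
      rw [leftStab_eq_rightStab_of_forall_comm hcomm, hS.2]
    rw [hsum] at h
    have hG : 0 < Nat.card G := Nat.card_pos
    nlinarith [h, hcardP]
  · rw [card_orbits_mul_card_group hρc ⊥, cmTypes_bot]
    have hunion : halfSystems ρ = simpleTypes ρ ⊥ ∪ simpleTypes ρ P := by
      ext S
      rw [Finset.mem_union, mem_halfSystems, mem_simpleTypes, mem_simpleTypes]
      constructor
      · intro hS
        rcases (hCM (rightStab S)).1 (hS.rho_not_mem_rightStab hρc hρ2) with h0 | h0
        · exact Or.inl ⟨hS, h0⟩
        · exact Or.inr ⟨hS, h0⟩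
      · rintro (⟨hS, -⟩ | ⟨hS, -⟩) <;> exact hS
    have hdisj : Disjoint (simpleTypes ρ ⊥) (simpleTypes ρ P) := by
      rw [Finset.disjoint_left]
      intro S h0 h1'
      rw [mem_simpleTypes] at h0 h1'
      exact hPb (h1'.2.symm.trans h0.2)
    have hs1 : ∑ S ∈ simpleTypes ρ ⊥, Nat.card (leftStab S) = (2 ^ (Fintype.card G / 2) - 2) * 1 := by
      rw [← card_simpleTypes_bot_of_cmSubgroups hρc hρ2 hCM hP hPb]
      exact Finset.sum_const_nat fun S hS => by
        rw [mem_simpleTypes] at hS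
        rw [leftStab_eq_rightStab_of_forall_comm hcomm, hS.2, Subgroup.card_bot]
    have hs2 : ∑ S ∈ simpleTypes ρ P, Nat.card (leftStab S) = 2 * Nat.card P := by
      rw [← h2]
      exact Finset.sum_const_nat fun S hS => by
        rw [mem_simpleTypes] at hS
        rw [leftStab_eq_rightStab_of_forall_comm hcomm, hS.2]
    rw [hunion, Finset.sum_union hdisj, hs1, hs2, ← hcardP]
    ring

/-! ### The cyclic group of order `2p` -/

/-- In a cyclic group an element of order dividing `2` is `1` or the given involution `ρ` (at most two square roots of
`1`). [folklore] -/
private theorem eq_one_or_eq_rho_of_sq [IsCyclic G] (hρ1 : ρ ≠ 1) (hρ2 : ρ * ρ = 1) {k : G} (hk : k * k = 1) :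
    k = 1 ∨ k = ρ := by
  by_contra h
  obtain ⟨hk1, hkρ⟩ : k ≠ 1 ∧ k ≠ ρ := by simpa [not_or] using h
  have hle := IsCyclic.card_pow_eq_one_le (α := G) (n := 2) (by norm_num)
  have h3 : ({1, ρ, k} : Finset G) ⊆ Finset.univ.filter fun a : G => a ^ 2 = 1 := by
    intro a ha
    simp only [Finset.mem_insert, Finset.mem_singleton] at ha
    simp only [Finset.mem_filter, Finset.mem_univ, true_and]
    rcases ha with rfl | rfl | rfl
    · exact one_pow 2
    · rw [pow_two, hρ2]
    · rw [pow_two, hk]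
  have hcard : ({1, ρ, k} : Finset G).card = 3 := by
    rw [Finset.card_insert_of_notMem, Finset.card_pair hkρ.symm]
    simp only [Finset.mem_insert, Finset.mem_singleton, not_or]
    exact ⟨hρ1.symm, hk1.symm⟩
  have := Finset.card_le_card h3
  rw [hcard] at this
  omega

/-- **The CM subgroups of `C_{2p}`**: for `G` cyclic of order `2p`, `p` an odd prime, with involution `ρ`, a subgroup
avoids `ρ` iff it is trivial or is the subgroup `P` of order `p` («`𝓗 = {⟨x²⟩, 1}`»).
[cite: Kida2019CountingCMTypes, Ex. 6.2] -/
theorem rho_not_mem_iff_of_isCyclic [IsCyclic G] {p : ℕ} (hp : p.Prime) (hp2 : p ≠ 2) (hG : Nat.card G = 2 * p)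
    (hρ1 : ρ ≠ 1) (hρ2 : ρ * ρ = 1) {P : Subgroup G} (hPcard : Nat.card P = p) (K : Subgroup G) :
    ρ ∉ K ↔ K = ⊥ ∨ K = P := by
  haveI : Fact p.Prime := ⟨hp⟩
  have hpodd : ¬ 2 ∣ p := fun h => hp2 ((Nat.prime_dvd_prime_iff_eq Nat.prime_two hp).1 h).symm
  -- elements of `P`, and of any subgroup of order `p`, are the solutions of `x^p = 1`
  have hsol : ∀ Q : Subgroup G, Nat.card Q = p → ∀ x : G, x ∈ Q ↔ x ^ p = 1 := by
    intro Q hQ x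
    constructor
    · intro hx
      have := orderOf_dvd_natCard (⟨x, hx⟩ : Q)
      rw [hQ, Subgroup.orderOf_mk] at this
      exact orderOf_dvd_iff_pow_eq_one.1 this
    · intro hx
      -- `Q ⊆ {x | x^p = 1}`, both of size `≤ p` and `|Q| = p`
      have hsub : (Finset.univ.filter fun a : G => a ∈ Q) ⊆ Finset.univ.filter fun a : G => a ^ p = 1 := by
        intro a ha
        simp only [Finset.mem_filter, Finset.mem_univ, true_and] at ha ⊢
        have := orderOf_dvd_natCard (⟨a, ha⟩ : Q)
        rw [hQ, Subgroup.orderOf_mk] at this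
        exact orderOf_dvd_iff_pow_eq_one.1 this
      have hle := IsCyclic.card_pow_eq_one_le (α := G) (n := p) hp.pos
      have hQcard : (Finset.univ.filter fun a : G => a ∈ Q).card = p := by
        rw [← hQ, Nat.card_eq_fintype_card, ← Fintype.card_subtype]
      have heq := Finset.eq_of_subset_of_card_le hsub (by rw [hQcard]; exact hle)
      have : x ∈ Finset.univ.filter fun a : G => a ^ p = 1 := by simp [hx]
      rw [← heq] at this
      simpa using this
  have hρP : ρ ∉ P := by
    rw [hsol P hPcard]
    intro h
    obtain ⟨m, hm⟩ := hp.odd_of_ne_two hp2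
    rw [hm, pow_succ, pow_mul, pow_two, hρ2, one_pow, one_mul] at h
    exact hρ1 h
  constructor
  · intro hρK
    have hdvd : Nat.card K ∣ 2 * p := hG ▸ K.card_subgroup_dvd_card
    -- `|K|` is odd: an element of order `2` in `K` would be `ρ`
    have hodd : ¬ 2 ∣ Nat.card K := by
      intro h2
      obtain ⟨k, hk⟩ := exists_prime_orderOf_dvd_card' (G := K) 2 h2
      have hk2 : (k : G) * k = 1 := by
        have := pow_orderOf_eq_one k
        rw [hk, pow_two] at this
        exact_mod_cast congrArg Subtype.val this
      rcases eq_one_or_eq_rho_of_sq hρ1 hρ2 hk2 with h | h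
      · have : orderOf k = 1 := by rw [orderOf_eq_one_iff]; exact_mod_cast h
        omega
      · exact hρK (h ▸ k.2)
    have hdvd' : Nat.card K ∣ p := (Nat.Coprime.dvd_of_dvd_mul_left
      (Nat.coprime_comm.1 ((Nat.Prime.coprime_iff_not_dvd Nat.prime_two).2 hodd)) hdvd)
    rcases (Nat.dvd_prime hp).1 hdvd' with h1 | hK
    · left
      exact Subgroup.eq_bot_of_card_eq K h1
    · right
      ext x
      rw [hsol K hK, hsol P hPcard]
  · rintro (rfl | rfl)
    · rwa [Subgroup.mem_bot]
    · exact hρP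

/-- A subgroup of order `p` of a cyclic group of order `2p` exists (and has index `2`). [folklore] -/
private theorem exists_subgroup_card_eq [IsCyclic G] {p : ℕ} (hp : p.Prime) (hG : Nat.card G = 2 * p) :
    ∃ P : Subgroup G, Nat.card P = p ∧ P.index = 2 ∧ P ≠ ⊥ := by
  haveI : Fact p.Prime := ⟨hp⟩
  obtain ⟨g, hg⟩ := exists_prime_orderOf_dvd_card' (G := G) p (by rw [hG]; exact dvd_mul_left p 2)
  refine ⟨Subgroup.zpowers g, by rw [Nat.card_zpowers, hg], ?_, ?_⟩
  · have := (Subgroup.zpowers g).card_mul_index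
    rw [Nat.card_zpowers, hg, hG, mul_comm 2 p] at this
    exact Nat.eq_of_mul_eq_mul_left hp.pos this
  · intro h
    rw [Subgroup.zpowers_eq_bot] at h
    rw [h, orderOf_one] at hg
    exact hp.one_lt.ne hg

/-- **EXAMPLE 6.2 (the cyclic group `C_{2p}`), the counts.**  For `G` cyclic of order `2p` (`p` an odd prime) with
involution `ρ`: `|X(1, 1)| = 2^p − 2` and `|X(P, P)| = 2` for the subgroup `P` of order `p` (all other
`X(H, K)` vanish by Cor. 2.7). [cite: Kida2019CountingCMTypes, Ex. 6.2] -/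
theorem card_X_of_isCyclic [IsCyclic G] {p : ℕ} (hp : p.Prime) (hp2 : p ≠ 2) (hG : Nat.card G = 2 * p)
    (hρ1 : ρ ≠ 1) (hρ2 : ρ * ρ = 1) {P : Subgroup G} (hPcard : Nat.card P = p) :
    (X ρ (⊥ : Subgroup G) ⊥).card = 2 ^ p - 2 ∧ (X ρ P P).card = 2 := by
  letI : CommGroup G := IsCyclic.commGroup
  have hcomm : ∀ a b : G, a * b = b * a := mul_comm
  have hCM := rho_not_mem_iff_of_isCyclic hp hp2 hG hρ1 hρ2 hPcard
  have hPi : P.index = 2 := by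
    have := P.card_mul_index
    rw [hPcard, hG, mul_comm 2 p] at this
    exact Nat.eq_of_mul_eq_mul_left hp.pos this
  have hPb : P ≠ ⊥ := by
    intro h
    rw [h, Subgroup.card_bot] at hPcard
    exact hp.one_lt.ne hPcard
  have h := card_X_of_cmSubgroups hρ2 hcomm hCM hPi hPb
  have hcardG : Fintype.card G / 2 = p := by rw [← Nat.card_eq_fintype_card, hG]; omega
  rwa [hcardG] at h

/-- **EXAMPLE 6.2, the numbers of conjugacy classes**: `c(C_{2p}, ⟨x²⟩, ρ) = 1` and
`c(C_{2p}, 1, ρ) = (2^{p−1} − 1)/p + 1` («The first term of the right-hand side … is an integer by Fermat's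
theorem»). [cite: Kida2019CountingCMTypes, Ex. 6.2] -/
theorem card_orbits_of_isCyclic [IsCyclic G] {p : ℕ} (hp : p.Prime) (hp2 : p ≠ 2) (hG : Nat.card G = 2 * p)
    (hρ1 : ρ ≠ 1) (hρ2 : ρ * ρ = 1) {P : Subgroup G} (hPcard : Nat.card P = p)
    (hρc : ∀ g : G, g * ρ = ρ * g) :
    Nat.card (MulAction.orbitRel.Quotient G (cmTypesSubMulAction ρ hρc P)) = 1 ∧
      Nat.card (MulAction.orbitRel.Quotient G (cmTypesSubMulAction ρ hρc ⊥)) = (2 ^ (p - 1) - 1) / p + 1 ∧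
      p ∣ 2 ^ (p - 1) - 1 := by
  letI : CommGroup G := IsCyclic.commGroup
  have hcomm : ∀ a b : G, a * b = b * a := mul_comm
  have hCM := rho_not_mem_iff_of_isCyclic hp hp2 hG hρ1 hρ2 hPcard
  have hPi : P.index = 2 := by
    have := P.card_mul_index
    rw [hPcard, hG, mul_comm 2 p] at this
    exact Nat.eq_of_mul_eq_mul_left hp.pos this
  have hPb : P ≠ ⊥ := by
    intro h
    rw [h, Subgroup.card_bot] at hPcard
    exact hp.one_lt.ne hPcard
  obtain ⟨h1, h2⟩ := card_orbits_of_cmSubgroups hρ2 hcomm hCM hPi hPb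
  have hcardG : Fintype.card G / 2 = p := by rw [← Nat.card_eq_fintype_card, hG]; omega
  rw [hcardG, hG] at h2
  -- Fermat: `p ∣ 2^{p-1} − 1`
  have hF : p ∣ 2 ^ (p - 1) - 1 := by
    have hcop : Nat.Coprime 2 p := (Nat.coprime_primes Nat.prime_two hp).2 hp2.symm
    have := Nat.ModEq.pow_card_sub_one_eq_one hp hcop
    exact (Nat.modEq_iff_dvd' (Nat.one_le_two_pow)).1 this.symm
  obtain ⟨m, hm⟩ := hF
  refine ⟨h1, ?_, ⟨m, hm⟩⟩
  have hp1 : 2 ^ p = 2 * 2 ^ (p - 1) := by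
    rw [← pow_succ', Nat.sub_add_cancel hp.one_lt.le]
  have hge : 1 ≤ 2 ^ (p - 1) := Nat.one_le_two_pow
  have e1 : 2 ^ p = 2 * (p * m) + 2 := by rw [hp1]; omega
  have h2' : Nat.card (MulAction.orbitRel.Quotient G (cmTypesSubMulAction ρ hρc ⊥)) * (2 * p) =
      (m + 1) * (2 * p) := by
    rw [h2, e1, Nat.add_sub_cancel]
    ring
  have hc := Nat.eq_of_mul_eq_mul_right (Nat.mul_pos two_pos hp.pos) h2'
  rw [hc, hm, Nat.mul_div_cancel_left _ hp.pos]

end ExampleCyclic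

/-! ## §9 The dictionary with CM types on a transitive `G`-set (Shimura's `S`, the tree's `IsPrimitive`) -/

section Dictionary

variable [Fintype G] {E : Type*} [MulAction G E] {ρ : G}

/-- Shimura's `S = {g | g·φh ∈ Φ}` of a type `Φ ⊆ E` at the base point `φh`, as a finite subset of `G` (the tree's
`typeLift`): the pull-back `S̃` of Kida, for `E = H\G` read through `S ↦ S⁻¹` (`E ≅ G/Stab(φh)`).
[cite: Kida2019CountingCMTypes, §1] -/
def liftFinset (Φ : Set E) (φh : E) : Finset G := Finset.univ.filter fun g => g • φh ∈ Φ

/-- The type `S·φh ⊆ E` swept out by `S ⊆ G`. [cite: Kida2019CountingCMTypes, §1] -/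
def sweep (S : Finset G) (φh : E) : Set E := {x | ∃ g ∈ S, g • φh = x}

omit [Fintype G] in
/-- For `S·Stab(φh) = S`: `g·φh ∈ S·φh ↔ g ∈ S`. [cite: Kida2019CountingCMTypes, §1] -/
theorem smul_mem_sweep_iff {S : Finset G} {φh : E} (hS : MulAction.stabilizer G φh ≤ rightStab S) (g : G) :
    g • φh ∈ sweep S φh ↔ g ∈ S := by
  constructor
  · rintro ⟨g', hg', hEq⟩
    have hk : g⁻¹ * g' ∈ MulAction.stabilizer G φh := by
      rw [MulAction.mem_stabilizer_iff, mul_smul, hEq, inv_smul_smul]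
    have h := mem_rightStab_iff.1 (hS hk) g
    rw [mul_inv_cancel_left] at h
    exact h.1 hg'
  · intro hg
    exact ⟨g, hg, rfl⟩

/-- Membership in `liftFinset` (unfolding; = `ReflexType.mem_typeLift`). [cite: Kida2019CountingCMTypes, §1] -/
@[simp] theorem mem_liftFinset {Φ : Set E} {φh : E} {g : G} : g ∈ liftFinset Φ φh ↔ g • φh ∈ Φ := by
  simp [liftFinset]

/-- `liftFinset Φ φh` is the tree's `typeLift Φ φh` as a finite set. [cite: Kida2019CountingCMTypes, §1] -/
theorem coe_liftFinset (Φ : Set E) (φh : E) : ((liftFinset Φ φh : Finset G) : Set G) = typeLift Φ φh := by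
  ext g
  rw [Finset.mem_coe, mem_liftFinset, mem_typeLift]

/-- A CM type `Φ ⊆ E` (tree: `IsCMTypeWith ρ Φ`) lifts to a CM type of `(G, Stab(φh), ρ)`: `S = liftFinset Φ φh` is a
half-system with `S·Stab(φh) = S`. [cite: Kida2019CountingCMTypes, §1] -/
theorem liftFinset_mem_cmTypes {Φ : Set E} (h : IsCMTypeWith ρ Φ) (φh : E) :
    liftFinset Φ φh ∈ cmTypes ρ (MulAction.stabilizer G φh) := by
  rw [mem_cmTypes]
  refine ⟨fun g => ?_, fun k hk => mem_rightStab_iff.2 fun g => ?_⟩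
  · rw [mem_liftFinset, mem_liftFinset, mul_smul]
    exact h.mem_iff _
  · rw [mem_liftFinset, mem_liftFinset, mul_smul, MulAction.mem_stabilizer_iff.1 hk]

/-- Conversely a CM type `S` of `(G, Stab(φh), ρ)` sweeps out a CM type `S·φh ⊆ E` for `ρ` (transitive action, `ρ`
central involution). [cite: Kida2019CountingCMTypes, §1] -/
theorem isCMTypeWith_sweep [MulAction.IsPretransitive G E] (hρc : ∀ g : G, g * ρ = ρ * g) (hρ2 : ρ * ρ = 1)
    {φh : E} {S : Finset G} (hS : S ∈ cmTypes ρ (MulAction.stabilizer G φh)) : IsCMTypeWith ρ (sweep S φh) := by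
  rw [mem_cmTypes] at hS
  refine ⟨fun x => ?_, fun g x => ?_, fun x => ?_⟩
  · obtain ⟨g, rfl⟩ := MulAction.exists_smul_eq G φh x
    rw [smul_mem_sweep_iff hS.2, ← mul_smul, smul_mem_sweep_iff hS.2]
    exact hS.1 g
  · rw [← mul_smul, ← mul_smul, hρc]
  · rw [← mul_smul, hρ2, one_smul]

/-- `liftFinset (S·φh) φh = S` for `S·Stab(φh) = S`. [cite: Kida2019CountingCMTypes, §1] -/
theorem liftFinset_sweep {φh : E} {S : Finset G} (hS : MulAction.stabilizer G φh ≤ rightStab S) :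
    liftFinset (sweep S φh) φh = S := by
  ext g
  rw [mem_liftFinset, smul_mem_sweep_iff hS]

/-- `(liftFinset Φ φh)·φh = Φ` for a transitive action. [cite: Kida2019CountingCMTypes, §1] -/
theorem sweep_liftFinset [MulAction.IsPretransitive G E] (Φ : Set E) (φh : E) :
    sweep (liftFinset (G := G) Φ φh) φh = Φ := by
  ext x
  obtain ⟨g, rfl⟩ := MulAction.exists_smul_eq G φh x
  constructor
  · rintro ⟨g', hg', hEq⟩
    rw [mem_liftFinset, hEq] at hg'
    exact hg'
  · intro hx
    exact ⟨g, mem_liftFinset.2 hx, rfl⟩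

/-- **Primitive ⟺ simple**: `Φ` is primitive at `φh` in the tree's sense (`ReflexType.IsPrimitive`, Shimura §8.2
Prop. 26: no subgroup strictly above `Stab(φh)` leaves `S` right-invariant) iff the right stabiliser of
`S = liftFinset Φ φh` is exactly `Stab(φh)` — Kida's «`S` is called simple if `s(S) = H`».
[cite: Kida2019CountingCMTypes, §1] -/
theorem isPrimitive_iff_rightStab_liftFinset_eq (Φ : Set E) (φh : E) :
    IsPrimitive G Φ φh ↔ rightStab (liftFinset Φ φh) = MulAction.stabilizer G φh := by
  rw [PrimitiveHalfSystemNonNormal.isPrimitive_iff_forall_mul_mem_typeLift]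
  have hle : MulAction.stabilizer G φh ≤ rightStab (liftFinset Φ φh) := fun k hk =>
    mem_rightStab_iff.2 fun g => by
      rw [mem_liftFinset, mem_liftFinset, mul_smul, MulAction.mem_stabilizer_iff.1 hk]
  constructor
  · intro h
    refine le_antisymm (fun γ hγ => h γ fun g => ?_) hle
    simpa only [mem_typeLift, mem_liftFinset] using (mem_rightStab_iff.1 hγ) g
  · intro h γ hγ
    rw [← h]
    exact mem_rightStab_iff.2 fun g => by simpa only [mem_typeLift, mem_liftFinset] using hγ g

/-- **CM types of the `G`-set `E` ↔ CM types of `(G, Stab(φh), ρ)`**: `Φ ↦ liftFinset Φ φh` is a bijection from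
`{Φ ⊆ E | IsCMTypeWith ρ Φ}` onto `CM(G, Stab(φh), ρ)` (inverse `S ↦ S·φh`). [cite: Kida2019CountingCMTypes, §1] -/
theorem natCard_isCMTypeWith_eq_card_cmTypes [MulAction.IsPretransitive G E] (hρc : ∀ g : G, g * ρ = ρ * g)
    (hρ2 : ρ * ρ = 1) (φh : E) :
    Nat.card {Φ : Set E // IsCMTypeWith ρ Φ} = (cmTypes ρ (MulAction.stabilizer G φh)).card := by
  rw [← Nat.card_eq_finsetCard]
  refine Nat.card_congr
    { toFun := fun Φ => ⟨liftFinset Φ.1 φh, liftFinset_mem_cmTypes Φ.2 φh⟩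
      invFun := fun S => ⟨sweep S.1 φh, isCMTypeWith_sweep hρc hρ2 S.2⟩
      left_inv := fun Φ => Subtype.ext (sweep_liftFinset Φ.1 φh)
      right_inv := fun S => Subtype.ext (liftFinset_sweep (mem_cmTypes.1 S.2).2) }

/-- **Primitive CM types of `E` at `φh` ↔ simple CM types `𝒮(Stab(φh))`** (same bijection).
[cite: Kida2019CountingCMTypes, §3 (3-1)] -/
theorem natCard_isPrimitive_eq_card_simpleTypes [MulAction.IsPretransitive G E] (hρc : ∀ g : G, g * ρ = ρ * g)
    (hρ2 : ρ * ρ = 1) (φh : E) :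
    Nat.card {Φ : Set E // IsCMTypeWith ρ Φ ∧ IsPrimitive G Φ φh} =
      (simpleTypes ρ (MulAction.stabilizer G φh)).card := by
  rw [← Nat.card_eq_finsetCard]
  refine Nat.card_congr
    { toFun := fun Φ => ⟨liftFinset Φ.1 φh, mem_simpleTypes.2
        ⟨(mem_cmTypes.1 (liftFinset_mem_cmTypes Φ.2.1 φh)).1,
          (isPrimitive_iff_rightStab_liftFinset_eq Φ.1 φh).1 Φ.2.2⟩⟩
      invFun := fun S => ⟨sweep S.1 φh,
        isCMTypeWith_sweep hρc hρ2 (mem_cmTypes.2 ⟨(mem_simpleTypes.1 S.2).1, (mem_simpleTypes.1 S.2).2.ge⟩),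
        (isPrimitive_iff_rightStab_liftFinset_eq _ φh).2
          (by rw [liftFinset_sweep (mem_simpleTypes.1 S.2).2.ge]; exact (mem_simpleTypes.1 S.2).2)⟩
      left_inv := fun Φ => Subtype.ext (sweep_liftFinset Φ.1 φh)
      right_inv := fun S => Subtype.ext (liftFinset_sweep (mem_simpleTypes.1 S.2).2.ge) }

/-- **THE NUMBER OF PRIMITIVE CM TYPES** of a finite transitive `G`-set with base point `φh` (for a CM field `K`:
`G = Gal(L/ℚ)` on `Hom(K, L)`, `H = Gal(L/K) = Stab(φh)`): Kida's Proposition 3.1 in the tree's vocabulary,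
`#{Φ | IsCMTypeWith ρ Φ ∧ IsPrimitive G Φ φh} = Σ_{N ⊇ H, ρ ∉ N} μ(H, N)·2^{½(G:N)}`.
[cite: Kida2019CountingCMTypes, Prop. 3.1] -/
theorem natCard_isPrimitive_eq_sum [MulAction.IsPretransitive G E] (hρc : ∀ g : G, g * ρ = ρ * g)
    (hρ2 : ρ * ρ = 1) (φh : E) :
    (Nat.card {Φ : Set E // IsCMTypeWith ρ Φ ∧ IsPrimitive G Φ φh} : ℤ) =
      ∑ N ∈ (Finset.Ici (MulAction.stabilizer G φh)).filter (fun N => ρ ∉ N),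
        IncidenceAlgebra.mu ℤ (MulAction.stabilizer G φh) N * 2 ^ (N.index / 2) := by
  rw [natCard_isPrimitive_eq_card_simpleTypes hρc hρ2, card_simpleTypes_eq_sum hρc hρ2]

/-- The total count in the tree's vocabulary: `#{Φ | IsCMTypeWith ρ Φ} = 2^{½(G : Stab(φh))} = 2^{|E|/2}` when `ρ`
moves `φh` (Dodson: «`K` has `2ⁿ` CM-types»; tree `IsCMTypeWith.natCard_setOf_isCMTypeWith`), and `0` otherwise.
[cite: Kida2019CountingCMTypes, Prop. 3.1 (proof)] -/
theorem natCard_isCMTypeWith_eq [MulAction.IsPretransitive G E] (hρc : ∀ g : G, g * ρ = ρ * g) (hρ2 : ρ * ρ = 1)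
    (φh : E) :
    Nat.card {Φ : Set E // IsCMTypeWith ρ Φ} =
      if ρ • φh = φh then 0 else 2 ^ ((MulAction.stabilizer G φh).index / 2) := by
  rw [natCard_isCMTypeWith_eq_card_cmTypes hρc hρ2, card_cmTypes hρc hρ2]
  rfl

end Dictionary

/-! ## §10 Field level: the number of primitive CM types of a CM field -/

section FieldLevel

open NumberField
open Literature.AlgebraicGeometry.Motives (CMType)

variable {L : Type} [Field L] [NumberField L] [IsCMField L] {K : Type} [Field K] [NumberField K]

/-- **THE NUMBER OF PRIMITIVE CM TYPES OF A CM FIELD** (Kida's Proposition 3.1 for `M = K`, `G = Gal(L/ℚ)`,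
`H = Gal(L/χ₀K)`): for a CM field `K`, a normal CM field `L` receiving it (`j`, base embedding `χ₀ : K → L`) and
`ι : L → ℂ`, the complex CM types `Θ : CMType K` that are PRIMITIVE (tree `IsPrimitive (ℂ ≃+* ℂ) Θ φ₀`, Shimura
§8.2 Prop. 26) number `Σ_{N ⊇ Stab(χ₀), ρ ∉ N} μ(Stab(χ₀), N)·2^{½(Gal(L/ℚ) : N)}`, the sum over the subgroups of
`Gal(L/ℚ)` fixing `χ₀(K)` pointwise and avoiding complex conjugation `ρ = conjGal` (= the CM subfields of `L`
containing `χ₀(K)`), `μ` the Möbius function of the subgroup lattice. [cite: Kida2019CountingCMTypes, Prop. 3.1] -/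
theorem natCard_isPrimitive_cmType_eq_sum [Normal ℚ L] (j : K →ₐ[ℚ] L) (ι : L →+* ℂ) (χ₀ : K →ₐ[ℚ] L)
    (φ₀ : K →+* ℂ) :
    (Nat.card {Θ : CMType K // IsPrimitive (ℂ ≃+* ℂ) Θ.1 φ₀} : ℤ) =
      ∑ N ∈ (Finset.Ici (MulAction.stabilizer (L ≃ₐ[ℚ] L) χ₀)).filter (fun N => (conjGal : L ≃ₐ[ℚ] L) ∉ N),
        IncidenceAlgebra.mu ℤ (MulAction.stabilizer (L ≃ₐ[ℚ] L) χ₀) N * 2 ^ (N.index / 2) := by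
  have hρc : ∀ g : L ≃ₐ[ℚ] L, g * conjGal = conjGal * g := fun g => (conjGal_central g).symm
  have e1 : {Θ : CMType K // IsPrimitive (ℂ ≃+* ℂ) Θ.1 φ₀} ≃
      {Ψ : {Ψ : Set (K →ₐ[ℚ] L) // IsCMTypeWith (conjGal : L ≃ₐ[ℚ] L) Ψ} //
        IsPrimitive (L ≃ₐ[ℚ] L) Ψ.1 χ₀} :=
    (cmTypeEquivIsCMTypeWithGal j ι).subtypeEquiv fun Θ =>
      PrimitiveCMTypeNonGalois.isPrimitive_iff_isPrimitive_algValuedIn j ι Θ χ₀ φ₀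
  have e2 : {Ψ : {Ψ : Set (K →ₐ[ℚ] L) // IsCMTypeWith (conjGal : L ≃ₐ[ℚ] L) Ψ} //
        IsPrimitive (L ≃ₐ[ℚ] L) Ψ.1 χ₀} ≃
      {Ψ : Set (K →ₐ[ℚ] L) // IsCMTypeWith (conjGal : L ≃ₐ[ℚ] L) Ψ ∧ IsPrimitive (L ≃ₐ[ℚ] L) Ψ χ₀} :=
    Equiv.subtypeSubtypeEquivSubtypeInter (fun Ψ : Set (K →ₐ[ℚ] L) => IsCMTypeWith (conjGal : L ≃ₐ[ℚ] L) Ψ)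
      (fun Ψ => IsPrimitive (L ≃ₐ[ℚ] L) Ψ χ₀)
  rw [Nat.card_congr (e1.trans e2), natCard_isPrimitive_eq_sum hρc conjGal_mul_conjGal χ₀]

/-- The same with `Stab(χ₀)` written as the Galois group `Gal(L/χ₀(K))` (`χ₀.fieldRange.fixingSubgroup`).
[cite: Kida2019CountingCMTypes, Prop. 3.1] -/
theorem natCard_isPrimitive_cmType_eq_sum_fixingSubgroup [Normal ℚ L] (j : K →ₐ[ℚ] L) (ι : L →+* ℂ)
    (χ₀ : K →ₐ[ℚ] L) (φ₀ : K →+* ℂ) :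
    (Nat.card {Θ : CMType K // IsPrimitive (ℂ ≃+* ℂ) Θ.1 φ₀} : ℤ) =
      ∑ N ∈ (Finset.Ici χ₀.fieldRange.fixingSubgroup).filter (fun N => (conjGal : L ≃ₐ[ℚ] L) ∉ N),
        IncidenceAlgebra.mu ℤ χ₀.fieldRange.fixingSubgroup N * 2 ^ (N.index / 2) := by
  rw [natCard_isPrimitive_cmType_eq_sum j ι χ₀ φ₀, stabilizer_algHom_eq_fixingSubgroup]

/-- For comparison, the total: the complex CM types of `K` correspond to the CM types of `(Gal(L/ℚ), Stab(χ₀), ρ)`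
and number `2^{½(Gal(L/ℚ) : Stab(χ₀))} = 2^{[K:ℚ]/2}` (tree `CMTypeCount.natCard_cmType`; here through Lemma 2.3).
[cite: Kida2019CountingCMTypes, Prop. 3.1 (proof)] -/
theorem natCard_cmType_eq_card_cmTypes [Normal ℚ L] (j : K →ₐ[ℚ] L) (ι : L →+* ℂ) (χ₀ : K →ₐ[ℚ] L) :
    Nat.card (CMType K) =
      (cmTypes (conjGal : L ≃ₐ[ℚ] L) (MulAction.stabilizer (L ≃ₐ[ℚ] L) χ₀)).card := by
  have hρc : ∀ g : L ≃ₐ[ℚ] L, g * conjGal = conjGal * g := fun g => (conjGal_central g).symm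
  rw [Nat.card_congr (cmTypeEquivIsCMTypeWithGal j ι), natCard_isCMTypeWith_eq_card_cmTypes hρc conjGal_mul_conjGal]

end FieldLevel

end CMTypeCounting

end Literature.NumberTheory.ComplexMultiplication
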